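import Summits.ResolutionOfSingularities.ResolutionOfSingularities.Theorems.HomologicalConductorNoZenoSplitCountSplitting
import Summits.ResolutionOfSingularities.ResolutionOfSingularities.Theorems.HomologicalConductorNoZenoSplitWeightFinite
import Summits.ResolutionOfSingularities.ResolutionOfSingularities.Theorems.HomologicalConductorNoZenoSpecResidueField
import Summits.ResolutionOfSingularities.ResolutionOfSingularities.Theorems.HomologicalConductorNoZenoSplitData
import HarnessLib

/-!
# Crux `NoZenoR` (stmt-ResolutionOfSingularities-19943), β layer, slot 5 seam0 (U2w):
# the split count UPSTAIRS over the one-root germ — finite, `≤ N`, all weights `1`, separable constant fields trivial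

Route `ResolutionOfSingularities/HomologicalConductor`, crux chain W4.4.  OURS (cell res-hironaka; object (U2w) of the seam0
«UPSTAIRS TRANSFER PACKAGE» (res-L0-w44-lead-1 SPEC 2026-08-27T21:26:18Z (U2), planner res-L0-w44-plan-1 DESK WORD 24/26),
hand res-D-pv-039; consumer: the slot-5 closer glue).  Assembly BY NAME of res-L0-w44-stub-2's BC-2/BC-2c
(`…NoZenoSplitCountSplitting.ncard_excCurvePoints_pullback_snd`), its ring ↔ `Spec` residue-field bridge
(`…NoZenoSpecResidueField`), res-L1-type-o5's finite-weight discharge (`…NoZenoSplitWeightFinite`) and res-D-pv-039's one-root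
germ bundle (`…NoZenoSplitData`: `finite_germ`, `isLocalHom_germ`, `map_maximalIdeal_germ`, `isSeparable_residueField_germ`);
AI-written, weaker than expert review; nothing here is a statement of the manuscript under review (Hironaka 2017); no Theses
file is imported.  Def-free, fact-free, `--supports 19943 --as helper`.

F-IN form: the thread polynomial `f` and the SPLITTING clause (in `ncard_excCurvePoints_pullback_snd`'s literal `hsplit` shape,
i.e. `exists_splittingField`'s output instantiated at the germ) are HYPOTHESES; the (F-out) wrapper chooses them.

* `isFinite_specMap_germ`, `preimage_closedPoint_germ` — `Spec D_f → Spec D` is finite and only the closed point lies over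
  the closed point;
* **`upstairs_count_le`** — for `π : X → Spec D` locally of finite type with finitely many integral exceptional curves and
  `splitExcCount π ≤ N`, and `π_f := pullback.snd π (Spec D_f → Spec D)`: `(excCurvePoints π_f).Finite`,
  `splitExcCount π_f ≤ N` (indeed `= splitExcCount π`), every split weight upstairs is `1`, and the separable closure of
  `κ(𝔪_{D_f})` in `κ(ζ)` is `⊥` for every `ζ ∈ excCurvePoints π_f` — the (U2) clause of the seam0 SPEC.

References: J. Lipman, Publ. Math. IHÉS 36 (1969), §16 (16.1) p. 231, §27 (27.3) p. 277 (context) [`Lipman1969`].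
-/

noncomputable section

-- single-problem summit: the doubled namespace component `ResolutionOfSingularities` is forced
set_option linter.dupNamespace false

namespace Summit.ResolutionOfSingularities.ResolutionOfSingularities.Theorems.NoZeno.ExcCount

open CategoryTheory CategoryTheory.Limits AlgebraicGeometry IsLocalRing Polynomial
open Literature.AlgebraicGeometry.Resolution
open Summit.ResolutionOfSingularities.ResolutionOfSingularities.Theorems.NoZeno.SandwichCluster
open Parasite (locPrime isLocalRing_locPrime)
open Summit.ResolutionOfSingularities.ResolutionOfSingularities.Theorems.NoZeno.SplittingBase

variable {k K : Type} [Field k] [Field K] [Algebra k K]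

section Germ

variable (D : Subalgebra k K) [IsLocalRing ↥D] (f : (↥D)[X]) [Fact (Irreducible (f.map (algebraMap ↥D K)))]

/-- `Spec D_f → Spec D` is FINITE (`D_f ≅ D[X]/(f)` is module-finite over `D`). [this work] -/
theorem isFinite_specMap_germ (hf : f.Monic) (hirr : Irreducible (f.map (residue ↥D)))
    (hPf : (splitPrime D f).IsPrime) :
    IsFinite (Spec.map (CommRingCat.ofHom
      (algebraMap ↥D ↥(locPrime (splitModel D f) (splitPrime D f) hPf)))) := by
  haveI := finite_germ D f hf hirr hPf
  rw [IsFinite.SpecMap_iff, CommRingCat.hom_ofHom, RingHom.finite_algebraMap]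
  infer_instance

/-- Only the closed point of `Spec D_f` lies over the closed point of `Spec D` (`𝔪_D D_f = 𝔪_{D_f}`). [this work] -/
theorem preimage_closedPoint_germ (hf : f.Monic) (hirr : Irreducible (f.map (residue ↥D)))
    (hPf : (splitPrime D f).IsPrime) :
    haveI := isLocalRing_locPrime (splitModel D f) (splitPrime D f) hPf
    (Spec.map (CommRingCat.ofHom
      (algebraMap ↥D ↥(locPrime (splitModel D f) (splitPrime D f) hPf)))).base ⁻¹' {closedPoint ↥D} =
      {closedPoint ↥(locPrime (splitModel D f) (splitPrime D f) hPf)} := by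
  haveI := isLocalRing_locPrime (splitModel D f) (splitPrime D f) hPf
  haveI := isLocalHom_germ D f hf hirr hPf
  exact preimage_closedPoint_eq_of_map_maximalIdeal _ _ (map_maximalIdeal_germ D f hf hirr hPf)

end Germ

section Count

variable (D : Subalgebra k K) [IsLocalRing ↥D] [IsNoetherianRing ↥D] (f : (↥D)[X])
  [Fact (Irreducible (f.map (algebraMap ↥D K)))]

/-- **(U2w) The split count upstairs over the one-root germ.**  `D ⊆ K` a local Noetherian `k`-subalgebra, `f ∈ D[X]` monic
with `f_K` irreducible and `f̄` irreducible separable, `D_f := locPrime (splitModel D f) (splitPrime D f)` the one-root germ and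
`g : Spec D_f → Spec D`; `π : X → Spec D` locally of finite type with finitely many integral exceptional curves,
`splitExcCount π ≤ N`, `hy` any proof that `Spec D_f → Spec D` maps the closed point to the closed point (e.g.
`specMap_closedPoint`), and `κ(𝔪_{D_f})` SPLITTING the separable constant field `κ(η)^s` of every `η ∈ excCurvePoints π` (the
literal `hsplit` of `ncard_excCurvePoints_pullback_snd`, = `exists_splittingField`'s output at `B := D_f`).  Then for
`π_f := pullback.snd π g`: `excCurvePoints π_f` is finite, `splitExcCount π_f = splitExcCount π ≤ N`, every split weight of
`π_f` is `1`, and for every `ζ ∈ excCurvePoints π_f` the separable closure of `κ(π_f ζ)` in `κ(ζ)` is `⊥`. [this work] -/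
theorem upstairs_count_le (hf : f.Monic) (hirr : Irreducible (f.map (residue ↥D)))
    (hsep : (f.map (residue ↥D)).Separable) (hPf : (splitPrime D f).IsPrime)
    {X : Scheme.{0}} (π : X ⟶ Spec (.of ↥D)) [LocallyOfFiniteType π] {N : ℕ}
    (hfinπ : (excCurvePoints π).Finite) (hle : splitExcCount π ≤ N)
    (hy : haveI := isLocalRing_locPrime (splitModel D f) (splitPrime D f) hPf
      (Spec.map (CommRingCat.ofHom (algebraMap ↥D ↥(locPrime (splitModel D f) (splitPrime D f) hPf)))).base
        (closedPoint ↥(locPrime (splitModel D f) (splitPrime D f) hPf)) = closedPoint ↥D)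
    (hsplit :
      haveI := isLocalRing_locPrime (splitModel D f) (splitPrime D f) hPf
      ∀ (η : X) (hη : η ∈ excCurvePoints π), letI := (π.residueFieldMap η).hom.toAlgebra
        letI := (((Spec (.of ↥D)).residueFieldCongr (hy.trans hη.1.symm)).inv ≫
          (Spec.map (CommRingCat.ofHom
            (algebraMap ↥D ↥(locPrime (splitModel D f) (splitPrime D f) hPf)))).residueFieldMap
            (closedPoint ↥(locPrime (splitModel D f) (splitPrime D f) hPf))).hom.toAlgebra
        ∀ x : separableClosure ((Spec (.of ↥D)).residueField (π.base η)) (X.residueField η),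
          ((minpoly ((Spec (.of ↥D)).residueField (π.base η)) x).map
            (algebraMap ((Spec (.of ↥D)).residueField (π.base η))
              ((Spec (.of ↥(locPrime (splitModel D f) (splitPrime D f) hPf))).residueField
                (closedPoint ↥(locPrime (splitModel D f) (splitPrime D f) hPf))))).Splits) :
    (excCurvePoints (pullback.snd π (Spec.map (CommRingCat.ofHom
        (algebraMap ↥D ↥(locPrime (splitModel D f) (splitPrime D f) hPf)))))).Finite ∧
      splitExcCount (pullback.snd π (Spec.map (CommRingCat.ofHom
        (algebraMap ↥D ↥(locPrime (splitModel D f) (splitPrime D f) hPf))))) = splitExcCount π ∧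
      splitExcCount (pullback.snd π (Spec.map (CommRingCat.ofHom
        (algebraMap ↥D ↥(locPrime (splitModel D f) (splitPrime D f) hPf))))) ≤ N ∧
      (∀ ζ ∈ excCurvePoints (pullback.snd π (Spec.map (CommRingCat.ofHom
          (algebraMap ↥D ↥(locPrime (splitModel D f) (splitPrime D f) hPf))))),
        splitWeight (pullback.snd π (Spec.map (CommRingCat.ofHom
          (algebraMap ↥D ↥(locPrime (splitModel D f) (splitPrime D f) hPf))))) ζ = 1) ∧
      (∀ ζ ∈ excCurvePoints (pullback.snd π (Spec.map (CommRingCat.ofHom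
          (algebraMap ↥D ↥(locPrime (splitModel D f) (splitPrime D f) hPf))))),
        letI := ((pullback.snd π (Spec.map (CommRingCat.ofHom
          (algebraMap ↥D ↥(locPrime (splitModel D f) (splitPrime D f) hPf))))).residueFieldMap ζ).hom.toAlgebra
        separableClosure
            ((Spec (.of ↥(locPrime (splitModel D f) (splitPrime D f) hPf))).residueField
              ((pullback.snd π (Spec.map (CommRingCat.ofHom
                (algebraMap ↥D ↥(locPrime (splitModel D f) (splitPrime D f) hPf))))).base ζ))
            ((pullback π (Spec.map (CommRingCat.ofHom
                (algebraMap ↥D ↥(locPrime (splitModel D f) (splitPrime D f) hPf))))).residueField ζ) = ⊥) := by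
  haveI := isLocalRing_locPrime (splitModel D f) (splitPrime D f) hPf
  haveI := isLocalHom_germ D f hf hirr hPf
  haveI := finite_germ D f hf hirr hPf
  haveI := isSeparable_residueField_germ D f hf hirr hsep hPf
  haveI := isFinite_specMap_germ D f hf hirr hPf
  have hg := preimage_closedPoint_germ D f hf hirr hPf
  haveI : Module.Finite (ResidueField ↥D) (ResidueField ↥(locPrime (splitModel D f) (splitPrime D f) hPf)) :=
    inferInstance
  have hfin := finite_residueFieldMap_closedPoint ↥D ↥(locPrime (splitModel D f) (splitPrime D f) hPf)
  have hsepκ := isSeparable_residueFieldMap_closedPoint ↥D ↥(locPrime (splitModel D f) (splitPrime D f) hPf)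
  have hFW : ∀ η ∈ excCurvePoints π, letI := (π.residueFieldMap η).hom.toAlgebra
      FiniteDimensional ((Spec (.of ↥D)).residueField (π.base η))
        (separableClosure ((Spec (.of ↥D)).residueField (π.base η)) (X.residueField η)) :=
    fun η _ => finiteDimensional_separableClosure_residueField π η
  have H := ncard_excCurvePoints_pullback_snd π (Spec.map (CommRingCat.ofHom
      (algebraMap ↥D ↥(locPrime (splitModel D f) (splitPrime D f) hPf)))) hg hy hfin hsepκ hfinπ hFW
  have H2 := H hsplit
  have hone := H2.1
  have hcount := H2.2.2
  have hfinB := excCurvePoints_pullback_snd_finite π (Spec.map (CommRingCat.ofHom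
      (algebraMap ↥D ↥(locPrime (splitModel D f) (splitPrime D f) hPf)))) hg hfinπ
  have hleB : splitExcCount (pullback.snd π (Spec.map (CommRingCat.ofHom
      (algebraMap ↥D ↥(locPrime (splitModel D f) (splitPrime D f) hPf))))) ≤ N := by
    rw [hcount]; exact hle
  refine ⟨hfinB, hcount, hleB, hone, fun ζ hζ => ?_⟩
  -- weight `1` + finite weights upstairs ⇒ the separable closure is `⊥`
  letI := ((pullback.snd π (Spec.map (CommRingCat.ofHom
    (algebraMap ↥D ↥(locPrime (splitModel D f) (splitPrime D f) hPf))))).residueFieldMap ζ).hom.toAlgebra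
  have hw := hone ζ hζ
  rw [splitWeight_eq_finrank] at hw
  exact IntermediateField.finrank_eq_one_iff.mp hw

end Count

end Summit.ResolutionOfSingularities.ResolutionOfSingularities.Theorems.NoZeno.ExcCount

end
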